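import Summits.ResolutionOfSingularities.ResolutionOfSingularities.Theorems.PurelyInseparableDim4ResConeCInfSecondTschirnhausFrame
import HarnessLib
import HarnessLib.Audit.Tags

/-!
# Purely inseparable four-folds — WHAT THE SECOND TSCHIRNHAUS KEEPS, FOR EVERY DEGREE `d` AND EVERY ROW `(eu, ef)`: the straight
# initial monomial `a·x_f^d`, the exact pair ledger below `x_f`-degree `d − 1`, dead rows, and the support dress of the window's
# binders (cell `res-dim4-pi`, K2(p) lane, rung-1 POWER-CONE LINE «light pair of TAIL(p, p−1, 3) ∀ p», window half W8b; the
# `p = 5` instance (`d = 4`, row `(2, 0)`) is res-dim4-typ-1 g3's `…ResConeCInfSecondTschirnhausFrame` p694363)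

[OURS · counted 0 · cell `res-dim4-pi` · K2(p) lane (holder res-dim4-p-12 g5); the ENTRY of the light-pair power-cone line is
res-dim4-p-3 g5's port (bus 2026-08-29 10:45Z), which imports this file BY NAME; the row parameter is the line owner's GO (10:50Z) on
res-dim4-typ-1 g5's Q-FLAG (10:47Z).]  Nothing here proves K2(p) for any `p`, any TAIL(p, p−1, 3), any TAIL(7, d, e),
`NoIsolatedTrap p p` or resolution of singularities in dimension ≥ 4 / characteristic `p` — NOT proved.  AI kernel work, weaker than
expert review.  Bookkeeping for OUR frame; kills nothing by itself.

The move is `τ = FrameChange.tsch u ψ` (`x_u ↦ x_u + ψ`, `ψ(0) = 0`, `f ∉ vars ψ`; `λ, μ ≠ u`).  The (5,4) file already has the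
`d`-free transports `coeff_tsch_fRow_eq_zero` (a dead `x_f^j`-row below a degree bound stays dead) and
`coeff_tsch_eq_zero_of_degree_lt` (degrees are not lowered); this file supplies the binders that carried a numeral there:
* §1 `tsch_pairLedger_le` — the exact pair ledger «`x_f`-degree `≤ k ⇒ x_λ^e x_μ^e ∣`» is transported monomialwise for ANY bound
  `k` (the (5,4) `tsch_pairLedger` is `k = 3`).  (A dead `(u, f)`-row is NOT in general kept by the move — it lowers `u`-exponents —
  which is why the window kills the row AFTER the move, W8 `exists_second_tschirnhaus_row_prime`.)
* §2 **`tsch_straight_pow`**, `tsch_straight_homogeneousComponent_pow` — `ord₀ G = d` with `in_d G = a·x_f^d` (coefficient dress /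
  `homogeneousComponent` dress) is kept: `τ(G − a x_f^d) ∈ 𝔪₀^{d+1}` and `τ(x_f^d) = x_f^d` (`coeff_C_mul_X_pow_eq`,
  `sub_C_mul_X_pow_mem_pow`).
* §3 the window's support dress: **`row_support_of_coeff`** («`coeff_m G = 0` for `(m_u, m_f) = (eu, ef)`, `|m| < B`» on the
  residual ⇒ «no monomial `d` of `F = x^r G` with `|d| < B + |r|` has `(d_u, d_f) = (eu, ef)`», `r` free of `u, f`) and
  **`pairLedger_support_of_coeff_le`** (the ledger read-off below `x_f`-degree `k` on `G` ⇒ the support form «`d_f ≤ k ⇒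
  d_λ, d_μ ≥ 2`» on `F = x_λx_μ G`).
[cite: CossartPiltant2009, I.8.3.6] [cite: Abhyankar1990, Lecture 26 pp. 228–229]
bears_on: LADDER-RESOLUTION:D157-DOOR2 (res-dim4-pi · K2(p) · power cones · second Tschirnhaus bookkeeping ∀ d ∀ row).  Supports
stmt-ResolutionOfSingularities-16155 (helper).
-/

set_option linter.dupNamespace false -- mandated namespace of this single-conjunct summit

noncomputable section

namespace Summit.ResolutionOfSingularities.ResolutionOfSingularities.Theorems.PIDim4

namespace ResCone

open MvPolynomial Finset FrameChange
open Literature.AlgebraicGeometry.Resolution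

variable {K : Type} [Field K]

/-! ## 1. The exact pair ledger below any `x_f`-degree -/

/-- **THE EXACT PAIR LEDGER IS TRANSPORTED MONOMIALWISE, any bound**: if every monomial of `P` of `x_f`-degree `≤ k` has
exponents `≥ e` at `λ` and at `μ` (`λ, μ ≠ u`), then so does every monomial of `tsch u ψ P` (the (5,4) `tsch_pairLedger` is `k = 3`).
[OURS] [folklore] -/
theorem tsch_pairLedger_le {u f lam mu : Fin 4} (huf : u ≠ f) (hlu : lam ≠ u) (hmu : mu ≠ u)
    {ψ : MvPolynomial (Fin 4) K} (hψ0 : constantCoeff ψ = 0) (hψf : f ∉ ψ.vars) {P : MvPolynomial (Fin 4) K}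
    {e k : ℕ} (hP : ∀ β ∈ P.support, β f ≤ k → e ≤ β lam ∧ e ≤ β mu) {γ : Fin 4 →₀ ℕ}
    (hγ : γ ∈ (tsch u ψ P).support) (hγf : γ f ≤ k) : e ≤ γ lam ∧ e ≤ γ mu := by
  obtain ⟨β, hβ, hβf, -, hle⟩ := exists_of_mem_support_tsch huf hψ0 hψf P hγ
  obtain ⟨h1, h2⟩ := hP β hβ (by rw [← hβf]; exact hγf)
  exact ⟨h1.trans (hle lam hlu), h2.trans (hle mu hmu)⟩

/-! ## 2. The straight initial monomial `a·x_f^d` is kept -/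

/-- Coefficients of `a·x_f^d`. [folklore] -/
theorem coeff_C_mul_X_pow_eq (f : Fin 4) (a : K) (d : ℕ) (n : Fin 4 →₀ ℕ) :
    coeff n (C a * X f ^ d : MvPolynomial (Fin 4) K) = if Finsupp.single f d = n then a else 0 := by
  rw [X_pow_eq_monomial, C_mul_monomial, mul_one, coeff_monomial]

/-- `ord₀ G = d` with `in_d G = a·x_f^d`, in coefficients, means `G − a·x_f^d ∈ 𝔪₀^{d+1}`. [folklore] -/
theorem sub_C_mul_X_pow_mem_pow {f : Fin 4} {G : MvPolynomial (Fin 4) K} {a : K} {d : ℕ}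
    (hlow : ∀ n : Fin 4 →₀ ℕ, n.degree < d → coeff n G = 0)
    (hd : ∀ n : Fin 4 →₀ ℕ, n.degree = d → coeff n G = if Finsupp.single f d = n then a else 0) :
    G - C a * X f ^ d ∈ originIdeal K ^ (d + 1) := by
  rw [IsolationCert.mem_originIdeal_pow_iff]
  intro m hm
  rw [coeff_sub, coeff_C_mul_X_pow_eq]
  rcases Nat.lt_or_ge m.degree d with h | h
  · rw [hlow m h, if_neg, sub_zero]
    intro heq
    rw [← heq, Finsupp.degree_single] at h
    exact lt_irrefl d h
  · rw [hd m (by omega), sub_self]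

/-- **THE STRAIGHT INITIAL MONOMIAL IS KEPT, every degree**: if `ord₀ G = d` and `in_d G = a·x_f^d` (coefficient dress), the same
holds for `tsch u ψ G` — `τ(G − a x_f^d) ∈ 𝔪₀^{d+1}` and `τ(x_f^d) = x_f^d`. [OURS] [cite: CossartPiltant2009, I.8.3.6] -/
theorem tsch_straight_pow {u f : Fin 4} (huf : u ≠ f) {ψ : MvPolynomial (Fin 4) K} (hψ0 : constantCoeff ψ = 0)
    {G : MvPolynomial (Fin 4) K} {a : K} {d : ℕ} (hlow : ∀ n : Fin 4 →₀ ℕ, n.degree < d → coeff n G = 0)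
    (hd : ∀ n : Fin 4 →₀ ℕ, n.degree = d → coeff n G = if Finsupp.single f d = n then a else 0) :
    (∀ n : Fin 4 →₀ ℕ, n.degree < d → coeff n (tsch u ψ G) = 0) ∧
      ∀ n : Fin 4 →₀ ℕ, n.degree = d → coeff n (tsch u ψ G) = if Finsupp.single f d = n then a else 0 := by
  have hτ0 : ∀ i, constantCoeff (tsch u ψ (X i)) = 0 := constantCoeff_tsch_X hψ0
  have hmem := map_mem_originIdeal_pow_of_origin (tsch u ψ) hτ0 (sub_C_mul_X_pow_mem_pow hlow hd)
  rw [map_sub, map_mul, map_pow, tsch_X_of_ne ψ huf.symm, IsolationCert.mem_originIdeal_pow_iff] at hmem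
  have hC : tsch u ψ (C a) = C a := by unfold tsch; rw [aeval_C, algebraMap_eq]
  rw [hC] at hmem
  have key : ∀ n : Fin 4 →₀ ℕ, n.degree ≤ d →
      coeff n (tsch u ψ G) = if Finsupp.single f d = n then a else 0 := by
    intro n hn
    have h := hmem n (by omega)
    rw [coeff_sub, coeff_C_mul_X_pow_eq, sub_eq_zero] at h
    exact h
  refine ⟨fun n hn => ?_, fun n hn => key n hn.le⟩
  rw [key n hn.le, if_neg]
  intro heq
  rw [← heq, Finsupp.degree_single] at hn
  exact lt_irrefl d hn

/-- The same in the `homogeneousComponent` dress: `ord₀`-part below `d` dead and `homogeneousComponent d G = C a * X f ^ d` are kept by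
`tsch u ψ`. [OURS] [cite: CossartPiltant2009, I.8.3.6] -/
theorem tsch_straight_homogeneousComponent_pow {u f : Fin 4} (huf : u ≠ f) {ψ : MvPolynomial (Fin 4) K}
    (hψ0 : constantCoeff ψ = 0) {G : MvPolynomial (Fin 4) K} {a : K} {d : ℕ}
    (hlow : ∀ n : Fin 4 →₀ ℕ, n.degree < d → coeff n G = 0) (hd : homogeneousComponent d G = C a * X f ^ d) :
    (∀ n : Fin 4 →₀ ℕ, n.degree < d → coeff n (tsch u ψ G) = 0) ∧
      homogeneousComponent d (tsch u ψ G) = C a * X f ^ d := by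
  classical
  have hd' : ∀ n : Fin 4 →₀ ℕ, n.degree = d → coeff n G = if Finsupp.single f d = n then a else 0 := by
    intro n hn
    have h := congrArg (coeff n) hd
    rw [coeff_homogeneousComponent, if_pos hn, coeff_C_mul_X_pow_eq] at h
    exact h
  obtain ⟨hlow', hdτ⟩ := tsch_straight_pow huf hψ0 hlow hd'
  refine ⟨hlow', ?_⟩
  ext n
  rw [coeff_homogeneousComponent, coeff_C_mul_X_pow_eq]
  by_cases hn : n.degree = d
  · rw [if_pos hn, hdτ n hn]
  · rw [if_neg hn, if_neg]
    intro hfn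
    rw [← hfn, Finsupp.degree_single] at hn
    exact hn rfl

/-! ## 3. The window's support dress, every row -/

/-- **Support dress of a dead `(u, f)`-row jet**: a coefficient statement «`coeff_m G = 0` for `(m_u, m_f) = (eu, ef)`, `|m| < B`» on
the residual becomes, on `F = x^r·G` (`r` free of `u, f`), «no monomial `d` of `F` with `|d| < B + |r|` has `(d_u, d_f) = (eu, ef)`»
(the `hrow` binder of W3 `SwapTransport.frame_step_zero_prime`; the (5,4) `uRow_support_of_coeff` is the row `(2, 0)`). [OURS] -/
theorem row_support_of_coeff {u f : Fin 4} {r : Fin 4 →₀ ℕ} (hru : r u = 0) (hrf : r f = 0)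
    {G : MvPolynomial (Fin 4) K} {B eu ef : ℕ}
    (h : ∀ m : Fin 4 →₀ ℕ, m u = eu → m f = ef → m.degree < B → coeff m G = 0)
    {d : Fin 4 →₀ ℕ} (hd : d ∈ (monomial r (1 : K) * G).support) (hdB : d.degree < B + r.degree) :
    ¬ (d u = eu ∧ d f = ef) := by
  rintro ⟨hdu, hdf⟩
  rw [mem_support_iff, coeff_monomial_mul'] at hd
  split_ifs at hd with hle
  · rw [one_mul] at hd
    refine hd (h (d - r) ?_ ?_ ?_)
    · rw [Finsupp.tsub_apply, hru, hdu, Nat.sub_zero]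
    · rw [Finsupp.tsub_apply, hrf, hdf, Nat.sub_zero]
    · have := congrArg Finsupp.degree (add_tsub_cancel_of_le hle)
      rw [map_add] at this
      omega
  · exact hd rfl

/-- **Support dress of the ledger jet, any `x_f`-bound**: «`coeff_n G = 0` for `n_f ≤ k`, `|n| < B`, `n_λ = 0 ∨ n_μ = 0`» on the
residual becomes, on `F = x_λ x_μ·G`, «every monomial `d` of `F` with `d_f ≤ k`, `|d| < B + 2` has `d_λ, d_μ ≥ 2`» (the (5,4)
`pairLedger_support_of_coeff` is `k = 3`; the window at `d + 1 = p` uses `k = d − 1`). [OURS] -/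
theorem pairLedger_support_of_coeff_le {lam mu f : Fin 4} (hlm : lam ≠ mu) (hfl : f ≠ lam) (hfm : f ≠ mu)
    {G : MvPolynomial (Fin 4) K} {B k : ℕ}
    (h : ∀ n : Fin 4 →₀ ℕ, n f ≤ k → n.degree < B → (n lam = 0 ∨ n mu = 0) → coeff n G = 0)
    {d : Fin 4 →₀ ℕ} (hd : d ∈ (monomial (Finsupp.single lam 1 + Finsupp.single mu 1) (1 : K) * G).support)
    (hdf : d f ≤ k) (hdB : d.degree < B + 2) : 2 ≤ d lam ∧ 2 ≤ d mu := by
  rw [mem_support_iff, coeff_monomial_mul'] at hd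
  split_ifs at hd with hle
  · rw [one_mul] at hd
    set n := d - (Finsupp.single lam 1 + Finsupp.single mu 1) with hn
    have hsplit : d = Finsupp.single lam 1 + Finsupp.single mu 1 + n := (add_tsub_cancel_of_le hle).symm
    have hl : d lam = 1 + n lam := by
      have := congrArg (fun g : Fin 4 →₀ ℕ => g lam) hsplit
      simp only [Finsupp.add_apply, Finsupp.single_eq_same, Finsupp.single_eq_of_ne hlm] at this
      omega
    have hm : d mu = 1 + n mu := by
      have := congrArg (fun g : Fin 4 →₀ ℕ => g mu) hsplit
      simp only [Finsupp.add_apply, Finsupp.single_eq_same, Finsupp.single_eq_of_ne hlm.symm] at this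
      omega
    have hf : n f = d f := by
      have := congrArg (fun g : Fin 4 →₀ ℕ => g f) hsplit
      simp only [Finsupp.add_apply, Finsupp.single_eq_of_ne hfl, Finsupp.single_eq_of_ne hfm] at this
      omega
    have hdeg : n.degree + 2 = d.degree := by
      have := congrArg Finsupp.degree hsplit
      simp only [map_add, Finsupp.degree_single] at this
      omega
    by_contra hcon
    refine hd (h n (by rw [hf]; exact hdf) (by omega) ?_)
    omega
  · exact absurd rfl hd

end ResCone

end Summit.ResolutionOfSingularities.ResolutionOfSingularities.Theorems.PIDim4

end
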